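import Literature.Algebra.EuclideanLattices.ARVerifier
import Literature.Algebra.EuclideanLattices.IntegerBases
import HarnessLib

/-!
# The integer-arithmetic verifier of the machine-level MR07 Thm. 5.23: definition and its two-sided link with tests (b′), (c)

Topic `Algebra/EuclideanLattices` (family `pqc`). The reduction of Micciancio–Regev 2007, Thm. 5.23
(authors' version pp. 28–31) ends by running a verifier on `N` witnesses `wⱼ ∈ L(B)*`. In the machine-level
rendering (towards `Literature.Computability.Cryptography.MicciancioRegev2007_gapCVP'_to_SIS'`) the witnesses
arrive as INTEGER vectors `uⱼ ∈ ℤⁿ` over a common positive denominator `D` (`wⱼ = uⱼ/D`; in the dual-grid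
model of the tree `D = det(B)²`, `DualGridCosetModel.lean`), the target `t ∈ ℤⁿ` is integral and `d = a/b`
is rational. Following the tree's integer Aharonov–Regev verifier (`ARVerifier.lean`), the machine decides,
with `eⱼ = ⟨t, uⱼ⟩`, `εⱼ = eⱼ − round(eⱼ/D)·D`, `G = [u₁ ⋯ u_N]` (`n × N`), `k = 2^P`:

  (b′)  `3 N D² ≤ 80 ∑ⱼ εⱼ²`                      — i.e. `∑ⱼ ‖⟨t, wⱼ⟩‖²_{ℝ/ℤ} ≥ (3/80) N`;
  (c′)  `(100 a²)^k · tr((G Gᵀ)^k) ≤ (3 N D² b²)^k`   — i.e. `tr((∑ⱼ wⱼwⱼᵀ)^k)^{1/k} ≤ 3N/(100 d²)`.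

This file defines that predicate (`intAcceptsZ`, all integer) and proves its two-sided relation with the
real tests of `MRGapCVPIdealisedZ.acceptsZ` on `wⱼ = uⱼ/D ∈ ℝⁿ`:

* `inner_witness_eq`, `distInt_inner_witness_eq`, `sum_distInt_sq_eq` — `⟨t, wⱼ⟩ = eⱼ/D` and
  `‖⟨t, wⱼ⟩‖_{ℝ/ℤ} = |εⱼ|/D`, so `∑ ‖⟨t, wⱼ⟩‖² = (∑ εⱼ²)/D²`;
* `sum_inner_witness_sq_eq` — `∑ⱼ ⟨x, wⱼ⟩² = xᵀ (G Gᵀ) x / D²` in coordinates;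
* `testB_of_intAcceptsZ`, `testC_of_intAcceptsZ` — **soundness direction** (what the machine's YES case
  needs): (b′) gives `(3/80) N ≤ ∑ ‖⟨t, wⱼ⟩‖²`, and (c′) gives `∑ⱼ ⟨x, wⱼ⟩² ≤ (3N/(100d²)) ‖x‖²` for all `x`
  (`ARVerifierAlgebra.dotProduct_mulVec_le_of_trace_pow_le`: `λ_max ≤ tr(·^k)^{1/k}`);
* `intAcceptsZ_of_tests` — **completeness direction** (what the NO case needs): if
  `θ_b N ≤ ∑ ‖⟨t, wⱼ⟩‖²` with `θ_b ≥ 3/80` and `∑ⱼ ⟨x, wⱼ⟩² ≤ Θ‖x‖²` for all `x` with the slack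
  `n (Θ d²)^k ≤ (3N/100)^k` (`tr(·^k) ≤ n λ_max^k`, `ARVerifierAlgebra.trace_pow_le_card_mul_pow`), then
  `intAcceptsZ` holds.

So the machine's verdict is sandwiched between two instances of the analysed predicate `acceptsZ`
(`θ_b = 3/80` with `Θ = 3N/(100d²)`, resp. any `Θ` with `n^{1/k} Θ ≤ 3N/(100d²)`). Definitions with bodies;
no named facts.

## References

* D. Micciancio, O. Regev, *Worst-case to average-case reductions based on Gaussian measures*,
  SIAM J. Comput. 37 (2007) 267–302; authors' version, Thm. 5.23 (the verifier `V`, p. 28; pp. 29–31).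
* D. Aharonov, O. Regev, *Lattice problems in NP ∩ coNP*, J. ACM 52 (2005) 749–765, §6, §6.1 (the
  integer form of the tests, as in the tree's `ARVerifier.lean`).
-/

noncomputable section

open Matrix Finset Literature.NumberTheory.Sieve.Vinogradov
open scoped Real InnerProductSpace

namespace Literature.Algebra.EuclideanLattices

namespace MicciancioRegev2007

namespace VerifierZ

variable {n N : ℕ}

/-! ### The integer data and the predicate -/

/-- The phase numerator `eⱼ = ⟨t, uⱼ⟩ ∈ ℤ` (`⟨t, wⱼ⟩ = eⱼ/D`). [folklore] -/
def phaseNum (t : Fin n → ℤ) (u : Fin N → Fin n → ℤ) (j : Fin N) : ℤ := t ⬝ᵥ u j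

/-- The residual `εⱼ = eⱼ − round(eⱼ/D)·D ∈ ℤ` (`|εⱼ|/D = ‖⟨t, wⱼ⟩‖_{ℝ/ℤ}`; the rounding is Lean's `round`
on `ℚ`, ties up, as computed by the tree's `qroundF`). [folklore] -/
def residual (t : Fin n → ℤ) (D : ℕ) (u : Fin N → Fin n → ℤ) (j : Fin N) : ℤ :=
  phaseNum t u j - round ((phaseNum t u j : ℚ) / (D : ℚ)) * D

/-- The `n × N` integer sample matrix `G = [u₁ ⋯ u_N]` (columns the witness numerators), so that the
integer moment matrix is `G Gᵀ = ∑ⱼ uⱼ uⱼᵀ`. [folklore] -/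
def sampleMat (u : Fin N → Fin n → ℤ) : Matrix (Fin n) (Fin N) ℤ := Matrix.of fun i j => u j i

/-- **The machine's acceptance predicate** on `(t, d = a/b, D, (uⱼ))` with `P` squarings: test (b′)
`3 N D² ≤ 80 ∑ⱼ εⱼ²` and test (c′) `(100 a²)^{2^P} tr((G Gᵀ)^{2^P}) ≤ (3 N D² b²)^{2^P}` — integer
arithmetic only (thresholds `θ_b = 3/80`, `θ_c = 3/100`). [cite: MicciancioRegev2007, Thm. 5.23 (the verifier V, p. 28) — integer form after AharonovRegev2005 §6 / the tree's ARVerifier] -/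
def intAcceptsZ (t : Fin n → ℤ) (a : ℤ) (b D P : ℕ) (u : Fin N → Fin n → ℤ) : Prop :=
  3 * (N : ℤ) * (D : ℤ) ^ 2 ≤ 80 * ∑ j, residual t D u j ^ 2 ∧
    (100 * a ^ 2) ^ (2 ^ P) * Matrix.trace ((sampleMat u * (sampleMat u)ᵀ) ^ (2 ^ P)) ≤
      (3 * (N : ℤ) * (D : ℤ) ^ 2 * (b : ℤ) ^ 2) ^ (2 ^ P)

/-! ### The real witnesses `wⱼ = uⱼ / D` -/

/-- The real witness `wⱼ = uⱼ/D ∈ ℝⁿ`. [folklore] -/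
def witness (D : ℕ) (u : Fin N → Fin n → ℤ) (j : Fin N) : EuclideanSpace ℝ (Fin n) :=
  (D : ℝ)⁻¹ • intVecToEuclidean n (u j)

/-- The real sample matrix `G` (cast). [folklore] -/
def sampleMatR (u : Fin N → Fin n → ℤ) : Matrix (Fin n) (Fin N) ℝ := (sampleMat u).map (Int.castRingHom ℝ)

/-- Entries of the sample matrix. [folklore] -/
@[simp] theorem sampleMat_apply (u : Fin N → Fin n → ℤ) (i : Fin n) (j : Fin N) : sampleMat u i j = u j i := rfl

/-- Entries of the real sample matrix. [folklore] -/
@[simp] theorem sampleMatR_apply (u : Fin N → Fin n → ℤ) (i : Fin n) (j : Fin N) :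
    sampleMatR u i j = ((u j i : ℤ) : ℝ) := rfl

/-- The real inner product of `ℝⁿ` is the dot product of coordinates. [folklore] -/
theorem inner_eq_dotProduct (x y : EuclideanSpace ℝ (Fin n)) :
    ⟪x, y⟫_ℝ = WithLp.ofLp x ⬝ᵥ WithLp.ofLp y := by
  rw [EuclideanSpace.inner_eq_star_dotProduct, star_trivial, dotProduct_comm]

/-- Coordinates of an integer vector. [folklore] -/
theorem ofLp_intVecToEuclidean (v : Fin n → ℤ) : WithLp.ofLp (intVecToEuclidean n v) = ARVerifier.castVec v := rfl

/-- **The phase**: `⟨t, wⱼ⟩ = eⱼ / D`. [folklore] -/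
theorem inner_witness_eq (t : Fin n → ℤ) {D : ℕ} (hD : 0 < D) (u : Fin N → Fin n → ℤ) (j : Fin N) :
    ⟪intVecToEuclidean n t, witness D u j⟫_ℝ = (phaseNum t u j : ℝ) / D := by
  have hD' : (D : ℝ) ≠ 0 := by exact_mod_cast hD.ne'
  rw [witness, inner_smul_right, inner_eq_dotProduct, ofLp_intVecToEuclidean, ofLp_intVecToEuclidean,
    ARVerifier.castVec_dotProduct, phaseNum]
  field_simp

/-- **The distance to `ℤ` of the phase is `|εⱼ|/D`.** [cite: AharonovRegev2005, §6 (p. 10: the nearest integers mⱼ) — variant] -/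
theorem distInt_inner_witness_eq (t : Fin n → ℤ) {D : ℕ} (hD : 0 < D) (u : Fin N → Fin n → ℤ) (j : Fin N) :
    distInt ⟪intVecToEuclidean n t, witness D u j⟫_ℝ = |(residual t D u j : ℝ)| / D := by
  have hD0 : (0 : ℝ) < D := by exact_mod_cast hD
  rw [inner_witness_eq t hD u j, distInt, residual]
  have hround : (round ((phaseNum t u j : ℝ) / D) : ℝ) = ((round ((phaseNum t u j : ℚ) / (D : ℚ)) : ℤ) : ℝ) := by
    congr 1
    have h : ((((phaseNum t u j : ℚ) / (D : ℚ)) : ℚ) : ℝ) = (phaseNum t u j : ℝ) / D := by push_cast; rfl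
    rw [← h, Rat.round_cast]
  rw [hround]
  push_cast
  rw [eq_div_iff hD0.ne', ← abs_of_pos hD0, ← abs_mul, abs_of_pos hD0]
  congr 1
  field_simp

/-- `∑ⱼ ‖⟨t, wⱼ⟩‖²_{ℝ/ℤ} = (∑ⱼ εⱼ²)/D²`. [folklore] -/
theorem sum_distInt_sq_eq (t : Fin n → ℤ) {D : ℕ} (hD : 0 < D) (u : Fin N → Fin n → ℤ) :
    ∑ j, distInt ⟪intVecToEuclidean n t, witness D u j⟫_ℝ ^ 2 = ((∑ j, residual t D u j ^ 2 : ℤ) : ℝ) / (D : ℝ) ^ 2 := by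
  push_cast
  rw [Finset.sum_div]
  refine Finset.sum_congr rfl fun j _ => ?_
  rw [distInt_inner_witness_eq t hD u j, div_pow, sq_abs]

/-- **The quadratic form**: `∑ⱼ ⟨x, wⱼ⟩² = xᵀ (G Gᵀ) x / D²` in coordinates. [folklore] -/
theorem sum_inner_witness_sq_eq {D : ℕ} (hD : 0 < D) (u : Fin N → Fin n → ℤ) (x : EuclideanSpace ℝ (Fin n)) :
    ∑ j, ⟪x, witness D u j⟫_ℝ ^ 2 =
      (WithLp.ofLp x ⬝ᵥ (sampleMatR u * (sampleMatR u)ᵀ) *ᵥ WithLp.ofLp x) / (D : ℝ) ^ 2 := by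
  have hD' : (D : ℝ) ≠ 0 := by exact_mod_cast hD.ne'
  rw [dotProduct_mul_transpose_mulVec, Finset.sum_div]
  refine Finset.sum_congr rfl fun j _ => ?_
  rw [witness, inner_smul_right, inner_eq_dotProduct, ofLp_intVecToEuclidean]
  have h : WithLp.ofLp x ⬝ᵥ ARVerifier.castVec (u j) = ∑ i, WithLp.ofLp x i * sampleMatR u i j := by
    simp [dotProduct, ARVerifier.castVec]
  rw [h]
  field_simp

/-- `‖x‖² = xᵀ x` in coordinates. [folklore] -/
theorem norm_sq_eq_dotProduct (x : EuclideanSpace ℝ (Fin n)) : ‖x‖ ^ 2 = WithLp.ofLp x ⬝ᵥ WithLp.ofLp x := by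
  rw [← real_inner_self_eq_norm_sq, inner_eq_dotProduct]

/-- Casting the trace of a power of the integer moment matrix. [folklore] -/
theorem cast_trace_pow (u : Fin N → Fin n → ℤ) (k : ℕ) :
    ((Matrix.trace ((sampleMat u * (sampleMat u)ᵀ) ^ k) : ℤ) : ℝ) =
      Matrix.trace ((sampleMatR u * (sampleMatR u)ᵀ) ^ k) := by
  have h1 : (Int.castRingHom ℝ) (Matrix.trace ((sampleMat u * (sampleMat u)ᵀ) ^ k)) =
      Matrix.trace (((sampleMat u * (sampleMat u)ᵀ) ^ k).map (Int.castRingHom ℝ)) :=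
    AddMonoidHom.map_trace (Int.castRingHom ℝ) _
  rw [eq_intCast] at h1
  rw [h1]
  congr 1
  have h2 : ((sampleMat u * (sampleMat u)ᵀ) ^ k).map ⇑(Int.castRingHom ℝ) =
      (Int.castRingHom ℝ).mapMatrix ((sampleMat u * (sampleMat u)ᵀ) ^ k) := rfl
  rw [h2, map_pow, RingHom.mapMatrix_apply, Matrix.map_mul, Matrix.transpose_map]
  rfl

/-! ### Soundness direction: the machine's tests imply the analysed tests -/

/-- **Test (b′) of the machine gives the real test (b′) with `θ_b = 3/80`**:
`3 N D² ≤ 80 ∑ εⱼ²` implies `(3/80) N ≤ ∑ⱼ ‖⟨t, wⱼ⟩‖²_{ℝ/ℤ}`. [cite: MicciancioRegev2007, Thm. 5.23 (the verifier, p. 28) — integer form] -/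
theorem testB_of_intAcceptsZ {t : Fin n → ℤ} {a : ℤ} {b D P : ℕ} (hD : 0 < D) {u : Fin N → Fin n → ℤ}
    (h : intAcceptsZ t a b D P u) :
    (3 / 80 : ℝ) * N ≤ ∑ j, distInt ⟪intVecToEuclidean n t, witness D u j⟫_ℝ ^ 2 := by
  have hD0 : (0 : ℝ) < D := by exact_mod_cast hD
  have h1 : (3 : ℝ) * N * (D : ℝ) ^ 2 ≤ 80 * ((∑ j, residual t D u j ^ 2 : ℤ) : ℝ) := by exact_mod_cast h.1
  rw [sum_distInt_sq_eq t hD u, le_div_iff₀ (by positivity)]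
  linarith

/-- **Test (c′) of the machine gives the real test (c) with `Θ = 3N/(100d²)`** (`d = a/b`, `a ≠ 0`,
`P ≥ 1`): `(100a²)^k tr((GGᵀ)^k) ≤ (3ND²b²)^k` implies `∑ⱼ ⟨x, wⱼ⟩² ≤ (3N/(100 d²)) ‖x‖²` for every `x`,
through `λ_max ≤ tr(·^k)^{1/k}` (`dotProduct_mulVec_le_of_trace_pow_le`).
[cite: MicciancioRegev2007, Thm. 5.23 (the verifier, p. 28) — trace form after AharonovRegev2005 §6] -/
theorem testC_of_intAcceptsZ {t : Fin n → ℤ} {a : ℤ} {b D P : ℕ} (ha : a ≠ 0) (hb : 0 < b) (hD : 0 < D)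
    (hP : 1 ≤ P) {u : Fin N → Fin n → ℤ} (h : intAcceptsZ t a b D P u) (x : EuclideanSpace ℝ (Fin n)) :
    ∑ j, ⟪x, witness D u j⟫_ℝ ^ 2 ≤ 3 * N / (100 * ((a : ℝ) / b) ^ 2) * ‖x‖ ^ 2 := by
  classical
  have hD0 : (0 : ℝ) < D := by exact_mod_cast hD
  have hb0 : (0 : ℝ) < b := by exact_mod_cast hb
  have ha0 : (0 : ℝ) < (a : ℝ) ^ 2 := by
    have : (a : ℝ) ≠ 0 := by exact_mod_cast ha
    positivity
  set T : Matrix (Fin n) (Fin n) ℝ := sampleMatR u * (sampleMatR u)ᵀ with hT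
  have hTsym : Tᵀ = T := transpose_mul_transpose_self _
  have hpsd : ∀ e, 0 ≤ e ⬝ᵥ T *ᵥ e := dotProduct_mul_transpose_mulVec_nonneg _
  -- the trace bound, cast to `ℝ` and divided out: `tr(T^k) ≤ Λ^k`, `Λ = 3 N D² b² / (100 a²)`
  set Λ : ℝ := 3 * N * (D : ℝ) ^ 2 * (b : ℝ) ^ 2 / (100 * (a : ℝ) ^ 2) with hΛ
  have hΛ0 : 0 ≤ Λ := by rw [hΛ]; positivity
  have h2 : (100 * (a : ℝ) ^ 2) ^ (2 ^ P) * Matrix.trace (T ^ (2 ^ P)) ≤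
      (3 * N * (D : ℝ) ^ 2 * (b : ℝ) ^ 2) ^ (2 ^ P) := by
    have h := h.2
    rw [hT, ← cast_trace_pow]
    exact_mod_cast h
  have htr : Matrix.trace (T ^ (2 ^ P)) ≤ Λ ^ (2 ^ P) := by
    rw [hΛ, div_pow, le_div_iff₀ (by positivity)]
    linarith
  have hq := dotProduct_mulVec_le_of_trace_pow_le hTsym hpsd hP hΛ0 htr (WithLp.ofLp x)
  rw [sum_inner_witness_sq_eq hD u x, norm_sq_eq_dotProduct, div_le_iff₀ (by positivity)]
  refine hq.trans (le_of_eq ?_)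
  rw [hΛ]
  field_simp

/-! ### Completeness direction: the analysed tests (with slack) imply the machine's tests -/

/-- **The analysed tests imply the machine's tests**: if `θ_b N ≤ ∑ⱼ ‖⟨t, wⱼ⟩‖²_{ℝ/ℤ}` with `θ_b ≥ 3/80`,
and `∑ⱼ ⟨x, wⱼ⟩² ≤ Θ‖x‖²` for all `x` with `Θ ≥ 0` and the slack `n (Θ d²)^k ≤ (3N/100)^k` (`k = 2^P`,
`P ≥ 1`, `d = a/b`), then `intAcceptsZ` holds (`tr(T^k) ≤ n λ_max^k`, `trace_pow_le_card_mul_pow`).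
[cite: MicciancioRegev2007, Thm. 5.23 (proof, NO case, p. 30) — trace form after AharonovRegev2005 Lemma 6.3] -/
theorem intAcceptsZ_of_tests {t : Fin n → ℤ} {a : ℤ} {b D P : ℕ} (hb : 0 < b) (hD : 0 < D) (hP : 1 ≤ P)
    {u : Fin N → Fin n → ℤ} {θb Θ : ℝ} (hθb : (3 / 80 : ℝ) ≤ θb) (hΘ0 : 0 ≤ Θ)
    (hslack : (n : ℝ) * (Θ * ((a : ℝ) / b) ^ 2) ^ (2 ^ P) ≤ (3 * N / 100) ^ (2 ^ P))
    (hB : θb * N ≤ ∑ j, distInt ⟪intVecToEuclidean n t, witness D u j⟫_ℝ ^ 2)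
    (hC : ∀ x : EuclideanSpace ℝ (Fin n), ∑ j, ⟪x, witness D u j⟫_ℝ ^ 2 ≤ Θ * ‖x‖ ^ 2) :
    intAcceptsZ t a b D P u := by
  classical
  have hD0 : (0 : ℝ) < D := by exact_mod_cast hD
  have hb0 : (0 : ℝ) < b := by exact_mod_cast hb
  have hN : (0 : ℝ) ≤ N := Nat.cast_nonneg _
  refine ⟨?_, ?_⟩
  · -- (b′)
    have h1 : θb * N ≤ ((∑ j, residual t D u j ^ 2 : ℤ) : ℝ) / (D : ℝ) ^ 2 := by
      rw [← sum_distInt_sq_eq t hD u]; exact hB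
    rw [le_div_iff₀ (by positivity)] at h1
    have h2 : (3 / 80 : ℝ) * N * (D : ℝ) ^ 2 ≤ θb * N * (D : ℝ) ^ 2 := by gcongr
    have h3 : (3 : ℝ) * N * (D : ℝ) ^ 2 ≤ 80 * ((∑ j, residual t D u j ^ 2 : ℤ) : ℝ) := by linarith
    exact_mod_cast h3
  · -- (c′)
    set T : Matrix (Fin n) (Fin n) ℝ := sampleMatR u * (sampleMatR u)ᵀ with hT
    have hTsym : Tᵀ = T := transpose_mul_transpose_self _
    have hpsd : ∀ e, 0 ≤ e ⬝ᵥ T *ᵥ e := dotProduct_mul_transpose_mulVec_nonneg _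
    -- the quadratic-form bound in coordinates: `eᵀ T e ≤ Θ D² ‖e‖²`
    have hform : ∀ e : Fin n → ℝ, e ⬝ᵥ T *ᵥ e ≤ Θ * (D : ℝ) ^ 2 * (e ⬝ᵥ e) := by
      intro e
      have h := hC (WithLp.toLp 2 e)
      rw [sum_inner_witness_sq_eq hD u, norm_sq_eq_dotProduct, WithLp.ofLp_toLp,
        div_le_iff₀ (by positivity)] at h
      linarith
    obtain ⟨P', rfl⟩ := Nat.exists_eq_add_of_le' hP
    have hk : 2 ^ (P' + 1) = 2 * 2 ^ P' := by rw [pow_succ, mul_comm]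
    have htr := trace_pow_le_card_mul_pow hTsym hpsd (by positivity) hform (2 ^ P')
    rw [← hk, Fintype.card_fin] at htr
    -- combine with the slack
    have hmain : (100 * (a : ℝ) ^ 2) ^ (2 ^ (P' + 1)) * Matrix.trace (T ^ (2 ^ (P' + 1))) ≤
        (3 * N * (D : ℝ) ^ 2 * (b : ℝ) ^ 2) ^ (2 ^ (P' + 1)) := by
      have hs : (n : ℝ) * (Θ * ((a : ℝ) / b) ^ 2) ^ (2 ^ (P' + 1)) * ((D : ℝ) ^ 2 * (b : ℝ) ^ 2 * 100) ^ (2 ^ (P' + 1)) ≤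
          (3 * N / 100) ^ (2 ^ (P' + 1)) * ((D : ℝ) ^ 2 * (b : ℝ) ^ 2 * 100) ^ (2 ^ (P' + 1)) :=
        mul_le_mul_of_nonneg_right hslack (by positivity)
      have hl : (100 * (a : ℝ) ^ 2) ^ (2 ^ (P' + 1)) * ((n : ℝ) * (Θ * (D : ℝ) ^ 2) ^ (2 ^ (P' + 1))) =
          (n : ℝ) * (Θ * ((a : ℝ) / b) ^ 2) ^ (2 ^ (P' + 1)) * ((D : ℝ) ^ 2 * (b : ℝ) ^ 2 * 100) ^ (2 ^ (P' + 1)) := by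
        have h1 : (100 * (a : ℝ) ^ 2) * (Θ * (D : ℝ) ^ 2) = (Θ * ((a : ℝ) / b) ^ 2) * ((D : ℝ) ^ 2 * (b : ℝ) ^ 2 * 100) := by
          field_simp
        calc (100 * (a : ℝ) ^ 2) ^ (2 ^ (P' + 1)) * ((n : ℝ) * (Θ * (D : ℝ) ^ 2) ^ (2 ^ (P' + 1)))
            = (n : ℝ) * ((100 * (a : ℝ) ^ 2) * (Θ * (D : ℝ) ^ 2)) ^ (2 ^ (P' + 1)) := by rw [mul_pow]; ring
          _ = (n : ℝ) * ((Θ * ((a : ℝ) / b) ^ 2) * ((D : ℝ) ^ 2 * (b : ℝ) ^ 2 * 100)) ^ (2 ^ (P' + 1)) := by rw [h1]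
          _ = _ := by rw [mul_pow]; ring
      have hr : (3 * N / 100 : ℝ) ^ (2 ^ (P' + 1)) * ((D : ℝ) ^ 2 * (b : ℝ) ^ 2 * 100) ^ (2 ^ (P' + 1)) =
          (3 * N * (D : ℝ) ^ 2 * (b : ℝ) ^ 2) ^ (2 ^ (P' + 1)) := by
        rw [← mul_pow]
        congr 1
        field_simp
      calc (100 * (a : ℝ) ^ 2) ^ (2 ^ (P' + 1)) * Matrix.trace (T ^ (2 ^ (P' + 1)))
          ≤ (100 * (a : ℝ) ^ 2) ^ (2 ^ (P' + 1)) * ((n : ℝ) * (Θ * (D : ℝ) ^ 2) ^ (2 ^ (P' + 1))) :=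
            mul_le_mul_of_nonneg_left htr (by positivity)
        _ = _ := hl
        _ ≤ _ := hs
        _ = _ := hr
    rw [hT, ← cast_trace_pow] at hmain
    exact_mod_cast hmain

/-! ### Admissible constants -/

/-- **The machine's threshold of test (c) dominates Lemma 5.20's**: `12/(49π²) < 3/100`
(`λ_max ≤ 12N s²β² = 12N/(49π²d²)` for the printed `s`; `π > 3`). [cite: MicciancioRegev2007, Thm. 5.23 (proof, p. 30)] -/
theorem twelve_div_lt : (12 : ℝ) / (49 * π ^ 2) < 3 / 100 := by
  have hπ : (3 : ℝ) < π := Real.pi_gt_three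
  rw [div_lt_div_iff₀ (by positivity) (by norm_num)]
  nlinarith

/-- `(3/100) d² < (3/80)`-type comparison used by the YES case: `Θ d² = 3N/100 < (3/80) N` for `N ≥ 1`.
[folklore] -/
theorem theta_c_lt_theta_b {N : ℕ} (hN : 1 ≤ N) {dd : ℝ} (hdd : dd ≠ 0) :
    3 * (N : ℝ) / (100 * dd ^ 2) * dd ^ 2 < 3 / 80 * N := by
  have hN' : (1 : ℝ) ≤ N := by exact_mod_cast hN
  have h : 3 * (N : ℝ) / (100 * dd ^ 2) * dd ^ 2 = 3 * N / 100 := by field_simp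
  rw [h]
  linarith

end VerifierZ

end MicciancioRegev2007

end Literature.Algebra.EuclideanLattices

end
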